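import Literature.NumberTheory.GaloisCohomology.ArchimedeanCyclicClassEvaluation
import Literature.NumberTheory.GaloisCohomology.KummerClassLocalSurjective
import HarnessLib

/-!
# Kummer theory at the REAL places: sign-prescribed approximation and the classes of `H¹(K_w, μₙ)`
# (archimedean input of Milne *ADT* I Thm. 4.10(b) for `μₙ` with the real places included)

Route `ThetaPartnerAtTwo`, crux K4 `SignedControlAtTwo` (stmt-BirchSwinnertonDyer-20309), line `eulerchar` v10, lead
`bsd-wall-tp2-p3` g4 (`--supports stmt-BirchSwinnertonDyer-20309`, helper).  WHY HERE: the registered stub of K4 is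
`Cassels ∧ Prop 4.12 ∧ poitouTate_selmerStructure_duality ℚ`; K4 lives at `p = 2` over `ℚ`, a field WITH a real place,
and every middle-exactness theorem of the tree's Poitou–Tate toolkit (cells bsd-schneider / bsd-stepL:
`middleExact_mu_level`, `middleExact_canonical_trivial_level`, `middleExact_canonical_of_card_eq_sq`, …) carries the
archimedean hypothesis `∀ w, w.IsReal → Odd n`.  The sequel `…MuRealMiddleExact` removes it in the base case
`M = μₙ`; this file supplies its archimedean Kummer inputs (file 1/2):

* `exists_forall_localization_δ₀_eq_of_signs` — the sign-prescribed Kummer approximation (the TODO of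
  `KummerClassLocalSurjective`): local classes at finitely many finite places AND prescribed signs at the real
  places are realised by one `b ∈ Kˣ`;
* `exists_unit_sign_localization_inl_δ₀_eq` — at an infinite place `w` every class of `H¹(K_w, μₙ(K̄)|)` is the
  localisation of the global Kummer class of `1` or of `-1` (local Kummer theory over `K_w ≅ ℝ, ℂ`: Hilbert 90 +
  `ℝ_{>0} = (ℝˣ)ⁿ`);
* `localization_inl_kummer_eq_of_eq_mul_pow` — `loc_w κₙ(b) = loc_w κₙ(a)` when `b = a·sⁿ` in `K_w`.

HONEST FRAMING. THEOREMS ONLY (no definition, no named fact, no instance, no sorry); textbook Kummer theory over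
`ℝ`/`ℂ` and weak approximation; closes no item; BSD is not proved by any of this.

References: [MilneADT2006] I Thm. 4.10(b), Thm. 2.6, Ex. 1.6 (c); [CasselsFrohlichANT1967] II §6 (weak approximation),
VII §5.1, §10; [SerreLocalFields1979] X §3, XIV §1; [NeukirchANT1999] VI §5 (5.6).
-/

noncomputable section

open CategoryTheory Function NumberField IsDedekindDomain Field ValuativeRel
open scoped NumberField ContRepresentation Topology

set_option linter.dupNamespace false
set_option autoImplicit false

namespace Summit.BirchSwinnertonDyer.BirchSwinnertonDyer.Theorems.SignedEC.MuReal

open _root_.ContinuousCohomology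
open Literature.NumberTheory.GaloisRepresentations
open Literature.NumberTheory.GaloisRepresentations.DiscreteGaloisModule
open Literature.NumberTheory.GaloisRepresentations.IsNonarchimedeanLocalField
open Literature.NumberTheory.GaloisCohomology
open Literature.NumberTheory.NumberFields
open Literature.AnabelianGeometry.AbsoluteAnabelian
open Literature.AnabelianGeometry.AbsoluteAnabelian.Prop121vii
open _root_.TopRep _root_.ContRepresentation

variable {K : Type} [Field K] [NumberField K] {n : ℕ} [NeZero n]

/-! ## §1. Sign-prescribed Kummer approximation -/

/-- **`H¹(K, μₙ) → ∏_{v ∈ S} H¹(K_v, μₙ)` is onto with PRESCRIBED SIGNS at the real places** (the TODO of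
`exists_forall_localization_δ₀_eq`): for a finite set `S` of finite places, local classes `t_v` (`v ∈ S`) and a
set `N` of infinite places, there is `b ∈ Kˣ` with `loc_v κₙ(b) = t_v` for `v ∈ S`, negative at the real places
in `N` and positive at the other real places — provided `K` has a real place (otherwise use
`exists_forall_localization_δ₀_eq`).  Weak approximation (`denseRange_algebraMap_pi_prod`) applied to the open
set `∏_{v∈S} x_v (K_vˣ)ⁿ × ∏_{w real} {sign = ∓}`. [cite: CasselsFrohlichANT1967, Ch. II §6]
[cite: SerreLocalFields1979, X §3] -/
theorem exists_forall_localization_δ₀_eq_of_signs (S : Finset (HeightOneSpectrum (𝓞 K)))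
    (t : ∀ v : HeightOneSpectrum (𝓞 K), galoisCohomology ((mu K n).toLocal (Sum.inr v)) 1)
    (N : Set (InfinitePlace K)) {w₀ : InfinitePlace K} (hw₀ : w₀.IsReal) :
    ∃ (b : K) (hb : b ≠ 0),
      (∀ (w : InfinitePlace K) (hw : w.IsReal), w ∈ N →
        InfinitePlace.Completion.extensionEmbeddingOfIsReal hw (algebraMap K w.Completion b) < 0) ∧
      (∀ (w : InfinitePlace K) (hw : w.IsReal), w ∉ N →
        0 < InfinitePlace.Completion.extensionEmbeddingOfIsReal hw (algebraMap K w.Completion b)) ∧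
      ∀ v ∈ S, galoisCohomology.localization (mu K n) (Sum.inr v) 1
        ((isSES_kummer K n (NeZero.pos n)).δ₀ (baseUnitsInvariant K b hb)) = t v := by
  classical
  -- local representatives
  have hloc : ∀ v : HeightOneSpectrum (𝓞 K), ∃ (x : v.adicCompletion K) (hx : x ≠ 0),
      (cohomologyMap (muLocalIso v n).hom 1).hom (t v) =
        (isSES_kummer (v.adicCompletion K) n (NeZero.pos n)).δ₀ (baseUnitsInvariant (v.adicCompletion K) x hx) :=
    fun v => exists_cohomologyMap_muLocalIso_eq_δ₀ v (t v)
  choose x hx0 hx using hloc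
  -- `Units.val : K_vˣ → K_v` is an open map
  have hvalopen : ∀ v : HeightOneSpectrum (𝓞 K),
      IsOpenMap (Units.val : (v.adicCompletion K)ˣ → v.adicCompletion K) := by
    intro v
    have hrange : Set.range (Units.val : (v.adicCompletion K)ˣ → v.adicCompletion K) = {0}ᶜ := by
      ext y
      simp only [Set.mem_range, Set.mem_compl_iff, Set.mem_singleton_iff]
      exact ⟨fun ⟨u, hu⟩ => hu ▸ u.ne_zero, fun hy => ⟨Units.mk0 y hy, rfl⟩⟩
    exact (⟨Units.isEmbedding_val₀, by rw [hrange]; exact isOpen_compl_singleton⟩ :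
      Topology.IsOpenEmbedding (Units.val : (v.adicCompletion K)ˣ → v.adicCompletion K)).isOpenMap
  -- the open cosets `x_v · (K_vˣ)ⁿ`
  set C : ∀ v : HeightOneSpectrum (𝓞 K), Set (v.adicCompletion K)ˣ := fun v =>
    (fun y => (Units.mk0 (x v) (hx0 v))⁻¹ * y) ⁻¹'
      ((powMonoidHom n : (v.adicCompletion K)ˣ →* (v.adicCompletion K)ˣ).range : Set (v.adicCompletion K)ˣ)
    with hCdef
  have hCopen : ∀ v, IsOpen (C v) := fun v => by
    haveI : CharZero (v.adicCompletion K) := charZero_adicCompletion v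
    exact (isOpen_range_powMonoidHom_units (v.adicCompletion K) (Nat.cast_ne_zero.mpr (NeZero.ne n))).preimage
      (continuous_const_mul _)
  -- the sign targets: `-1` on `N`, `+1` off `N`
  set sgn : InfinitePlace K → ℝ := fun w => if w ∈ N then -1 else 1 with hsgn
  have hsgn_ne : ∀ w, sgn w ≠ 0 := fun w => by
    by_cases h : w ∈ N <;> simp [hsgn, h]
  -- the same signs as elements of the completions
  set sgnW : ∀ w : InfinitePlace K, w.Completion := fun w => if w ∈ N then -1 else 1 with hsgnW
  have hsgnW : ∀ (w : InfinitePlace K) (hw : w.IsReal),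
      InfinitePlace.Completion.extensionEmbeddingOfIsReal hw (sgnW w) = sgn w := fun w hw => by
    by_cases h : w ∈ N <;> simp [hsgnW, hsgn, h]
  set O : Set ((∀ v : S, v.1.adicCompletion K) × InfiniteAdeleRing K) :=
    {p | (∀ v : S, p.1 v ∈ Units.val '' C v.1) ∧
      ∀ (w : InfinitePlace K) (hw : w.IsReal),
        0 < sgn w * InfinitePlace.Completion.extensionEmbeddingOfIsReal hw (p.2 w)} with hOdef
  have hOopen : IsOpen O := by
    have h1 : IsOpen {p : (∀ v : S, v.1.adicCompletion K) × InfiniteAdeleRing K |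
        ∀ v : S, p.1 v ∈ Units.val '' C v.1} := by
      rw [Set.setOf_forall]
      exact isOpen_iInter_of_finite fun v =>
        ((hvalopen v.1) _ (hCopen v.1)).preimage ((continuous_apply v).comp continuous_fst)
    have h2 : IsOpen {p : (∀ v : S, v.1.adicCompletion K) × InfiniteAdeleRing K |
        ∀ (w : InfinitePlace K) (hw : w.IsReal),
          0 < sgn w * InfinitePlace.Completion.extensionEmbeddingOfIsReal hw (p.2 w)} := by
      rw [Set.setOf_forall]
      refine isOpen_iInter_of_finite fun w => ?_
      by_cases hw : w.IsReal
      · have hc : Continuous fun p : (∀ v : S, v.1.adicCompletion K) × InfiniteAdeleRing K =>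
            sgn w * InfinitePlace.Completion.extensionEmbeddingOfIsReal hw (p.2 w) :=
          continuous_const.mul
            ((InfinitePlace.Completion.isometry_extensionEmbeddingOfIsReal hw).continuous.comp
              ((continuous_apply w).comp continuous_snd))
        have : {p : (∀ v : S, v.1.adicCompletion K) × InfiniteAdeleRing K |
            ∀ hw' : w.IsReal, 0 < sgn w * InfinitePlace.Completion.extensionEmbeddingOfIsReal hw' (p.2 w)} =
            (fun p => sgn w * InfinitePlace.Completion.extensionEmbeddingOfIsReal hw (p.2 w)) ⁻¹' Set.Ioi 0 := by
          ext p
          simp only [Set.mem_setOf_eq, Set.mem_preimage, Set.mem_Ioi]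
          exact ⟨fun h => h hw, fun h _ => h⟩
        rw [this]
        exact isOpen_Ioi.preimage hc
      · have : {p : (∀ v : S, v.1.adicCompletion K) × InfiniteAdeleRing K |
            ∀ hw' : w.IsReal, 0 < sgn w * InfinitePlace.Completion.extensionEmbeddingOfIsReal hw' (p.2 w)} =
            Set.univ :=
          Set.eq_univ_of_forall fun p hw' => absurd hw' hw
        rw [this]
        exact isOpen_univ
    exact h1.inter h2
  have hOne : O.Nonempty := by
    refine ⟨(fun v => x v.1, fun w => sgnW w), fun v => ⟨Units.mk0 (x v.1) (hx0 v.1), ?_, rfl⟩,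
      fun w hw => ?_⟩
    · change (Units.mk0 (x v.1) (hx0 v.1))⁻¹ * Units.mk0 (x v.1) (hx0 v.1) ∈
        (((powMonoidHom n : (v.1.adicCompletion K)ˣ →* (v.1.adicCompletion K)ˣ).range : Subgroup _) :
          Set (v.1.adicCompletion K)ˣ)
      rw [inv_mul_cancel]
      exact Subgroup.one_mem _
    · change 0 < sgn w * InfinitePlace.Completion.extensionEmbeddingOfIsReal hw (sgnW w)
      rw [hsgnW w hw]
      exact mul_self_pos.mpr (hsgn_ne w)
  obtain ⟨b, hb⟩ := (denseRange_algebraMap_pi_prod (K := K) S).exists_mem_open hOopen hOne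
  obtain ⟨hbfin, hbinf⟩ := hb
  -- `b ≠ 0`: its sign at `w₀` is prescribed
  have hb0 : b ≠ 0 := by
    intro h
    have h0 := hbinf w₀ hw₀
    change 0 < sgn w₀ * InfinitePlace.Completion.extensionEmbeddingOfIsReal hw₀ (algebraMap K w₀.Completion b) at h0
    rw [h, map_zero, map_zero, mul_zero] at h0
    exact lt_irrefl _ h0
  have hsign : ∀ (w : InfinitePlace K) (hw : w.IsReal),
      0 < sgn w * InfinitePlace.Completion.extensionEmbeddingOfIsReal hw (algebraMap K w.Completion b) :=
    fun w hw => hbinf w hw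
  refine ⟨b, hb0, fun w hw hwN => ?_, fun w hw hwN => ?_, fun v hv => ?_⟩
  · have h := hsign w hw
    rw [hsgn] at h
    simp only [if_pos hwN] at h
    linarith
  · have h := hsign w hw
    rw [hsgn] at h
    simp only [if_neg hwN, one_mul] at h
    exact h
  · obtain ⟨u, huC, hu⟩ := hbfin ⟨v, hv⟩
    obtain ⟨s, hs⟩ := huC
    have hu' : (u : v.adicCompletion K) = algebraMap K (v.adicCompletion K) b := hu
    refine localization_δ₀_baseUnitsInvariant_eq_of_eq_mul_pow v (t v) (hx0 v) (hx v) b hb0 s.ne_zero ?_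
    rw [← hu', ← Units.val_mk0 (hx0 v), ← Units.val_pow_eq_pow_val, ← Units.val_mul, ← powMonoidHom_apply, hs,
      mul_inv_cancel_left]

/-! ## §2. Archimedean local Kummer theory: every class at an infinite place is `loc_w κₙ(±1)` -/

omit [NumberField K] [NeZero n] in
/-- `baseUnitsInvariant` only depends on the element (proof-irrelevance helper). [folklore] -/
private theorem baseUnitsInvariant_congr {F : Type} [Field F] {x y : F} (hx : x ≠ 0) (hy : y ≠ 0) (h : x = y) :
    baseUnitsInvariant F x hx = baseUnitsInvariant F y hy := by
  subst h; rfl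

/-- **`loc_w κₙ(b) = loc_w κₙ(a)` at an infinite place `w` when `b = a · sⁿ` in `K_w`** (infinite-place twin of
`localization_kummer_eq_of_eq_mul_pow`: `κₙ(b) = κₙ(a) + κₙ(b/a)` and `loc_w κₙ(b/a) = 0` since `b/a = sⁿ` in `K_w`,
`localization_inl_δ₀_baseUnitsInvariant_eq_zero_of_eq_pow`). [cite: SerreLocalFields1979, X §3] -/
theorem localization_inl_kummer_eq_of_eq_mul_pow (w : InfinitePlace K) (a b : K) (ha : a ≠ 0) (hb : b ≠ 0)
    {s : w.Completion} (h : algebraMap K w.Completion b = algebraMap K w.Completion a * s ^ n) :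
    haveI : CompactSpace (absoluteGaloisGroup K) := absoluteGaloisGroup_compactSpace K
    haveI : CompactSpace (absoluteGaloisGroup w.Completion) := absoluteGaloisGroup_compactSpace _
    galoisCohomology.localization (mu K n) (Sum.inl w) 1
        ((isSES_kummer K n (NeZero.pos n)).δ₀ (baseUnitsInvariant K b hb)) =
      galoisCohomology.localization (mu K n) (Sum.inl w) 1
        ((isSES_kummer K n (NeZero.pos n)).δ₀ (baseUnitsInvariant K a ha)) := by
  haveI : CompactSpace (absoluteGaloisGroup K) := absoluteGaloisGroup_compactSpace K
  haveI : CompactSpace (absoluteGaloisGroup w.Completion) := absoluteGaloisGroup_compactSpace _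
  have hq : b / a ≠ 0 := div_ne_zero hb ha
  have hba : b = a * (b / a) := by field_simp
  have hs : algebraMap K w.Completion (b / a) = s ^ n := by
    have ha' : algebraMap K w.Completion a ≠ 0 := (map_ne_zero_iff _ (algebraMap K _).injective).2 ha
    rw [map_div₀, h, mul_div_cancel_left₀ _ ha']
  rw [baseUnitsInvariant_congr hb (mul_ne_zero ha hq) hba, baseUnitsInvariant_mul K a (b / a) ha hq, map_add]
  erw [map_add]
  rw [localization_inl_δ₀_baseUnitsInvariant_eq_zero_of_eq_pow w (b / a) hq hs, add_zero]

/-- **At an infinite place `w`, every class of `H¹(K_w, μₙ(K̄)|)` is `loc_w κₙ(e)` with `e ∈ {1, -1}`.**  Along the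
transfer isomorphism `μₙ(K̄)|_{Γ_{K_w}} ≅ μₙ(K̄_w)` (`muTransferEquiv`, `resMu_eq_of_localization_inl`) the class is a
local Kummer class `κₙ(x)`, `x ∈ K_wˣ` (Hilbert 90, `exists_δ₀_baseUnitsInvariant_eq`); in `K_w ≅ ℝ` one has
`x = ± sⁿ` according to the sign of `x` (`exists_pow_eq_of_pos`), in `K_w ≅ ℂ` `x = sⁿ`; and
`κₙ(±1 · sⁿ) = κₙ(±1) = Res κₙ(±1)` (`δ₀_baseUnitsInvariant_mul_pow`, `resMu_δ₀_baseUnitsInvariant`).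
[cite: SerreLocalFields1979, X §3] [cite: NeukirchANT1999, Ch. VI §5 Prop. (5.6)] -/
theorem exists_unit_sign_localization_inl_δ₀_eq (w : InfinitePlace K)
    (c : galoisCohomology ((mu K n).toLocal (Sum.inl w)) 1) :
    ∃ (e : K) (he : e ≠ 0), (e = 1 ∨ e = -1) ∧
      haveI : CompactSpace (absoluteGaloisGroup K) := absoluteGaloisGroup_compactSpace K
      haveI : CompactSpace (absoluteGaloisGroup w.Completion) := absoluteGaloisGroup_compactSpace _
      galoisCohomology.localization (mu K n) (Sum.inl w) 1
        ((isSES_kummer K n (NeZero.pos n)).δ₀ (baseUnitsInvariant K e he)) = c := by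
  classical
  haveI : CompactSpace (absoluteGaloisGroup K) := absoluteGaloisGroup_compactSpace K
  haveI : CompactSpace (absoluteGaloisGroup w.Completion) := absoluteGaloisGroup_compactSpace _
  haveI : CharZero w.Completion := charZero_of_injective_algebraMap (algebraMap K w.Completion).injective
  -- the transfer isomorphism `μₙ(K̄)| ≅ μₙ(K̄_w)`
  let isoW : ((mu K n).restrict (absGaloisRestrict K w.Completion)).toTopRep ≅ (mu w.Completion n).toTopRep :=
    topRepIsoOfEquiv (X := ((mu K n).restrict (absGaloisRestrict K w.Completion)).toTopRep)
      (Y := (mu w.Completion n).toTopRep)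
      { (muTransferEquiv K w.Completion n).toIntLinearEquiv with
        continuous_toFun := continuous_of_discreteTopology
        continuous_invFun := continuous_of_discreteTopology }
      fun σ y => muTransfer_mu K w.Completion n σ y
  have hinj : Injective (fun c => (cohomologyMap isoW.hom 1).hom c) :=
    (continuousCohomologyEquivOfIso isoW 1).injective
  -- the transported class is a local Kummer class `κₙ(x)`, `x ∈ K_wˣ`
  obtain ⟨x, hx0, hx⟩ := exists_δ₀_baseUnitsInvariant_eq w.Completion ((cohomologyMap isoW.hom 1).hom c)
  -- `x = e · sⁿ` with `e = ±1`
  obtain ⟨e, s, he1, hxe⟩ : ∃ (e : K) (s : w.Completion), (e = 1 ∨ e = -1) ∧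
      x = algebraMap K w.Completion e * s ^ n := by
    rcases w.isReal_or_isComplex with hw | hw
    · set r := InfinitePlace.Completion.extensionEmbeddingOfIsReal hw x with hr
      have hr0 : r ≠ 0 := by
        rw [hr, map_ne_zero_iff _ (InfinitePlace.Completion.extensionEmbeddingOfIsReal hw).injective]
        exact hx0
      rcases lt_or_gt_of_ne hr0 with hneg | hpos
      · have hpos' : 0 < InfinitePlace.Completion.extensionEmbeddingOfIsReal hw (-x) := by
          rw [map_neg]; exact neg_pos.mpr hneg
        obtain ⟨s, hs⟩ := exists_pow_eq_of_pos (n := n) hw (-x) hpos'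
        refine ⟨-1, s, Or.inr rfl, ?_⟩
        rw [map_neg, map_one, neg_one_mul, ← hs, neg_neg]
      · obtain ⟨s, hs⟩ := exists_pow_eq_of_pos (n := n) hw x hpos
        exact ⟨1, s, Or.inl rfl, by rw [map_one, one_mul]; exact hs⟩
    · obtain ⟨s, hs⟩ := exists_pow_eq_of_isComplex (n := n) hw (NeZero.pos n) x
      exact ⟨1, s, Or.inl rfl, by rw [map_one, one_mul]; exact hs⟩
  have he0 : e ≠ 0 := by rcases he1 with rfl | rfl <;> norm_num
  have he0' : algebraMap K w.Completion e ≠ 0 := (map_ne_zero_iff _ (algebraMap K _).injective).2 he0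
  have hs0 : s ≠ 0 := by
    rintro rfl
    rw [zero_pow (NeZero.ne n), mul_zero] at hxe
    exact hx0 hxe
  refine ⟨e, he0, he1, hinj ?_⟩
  change (cohomologyMap isoW.hom 1).hom (galoisCohomology.localization (mu K n) (Sum.inl w) 1 _) =
    (cohomologyMap isoW.hom 1).hom c
  rw [resMu_eq_of_localization_inl w 1 _ isoW.hom (fun _ => rfl),
    resMu_δ₀_baseUnitsInvariant K w.Completion e he0 he0', ← hx,
    baseUnitsInvariant_congr hx0 (mul_ne_zero he0' (pow_ne_zero n hs0)) hxe,
    δ₀_baseUnitsInvariant_mul_pow w.Completion _ s he0' hs0]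

end Summit.BirchSwinnertonDyer.BirchSwinnertonDyer.Theorems.SignedEC.MuReal

end
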